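import Literature.NumberTheory.Sieve.MoebiusShiftedPrimesMajorArcs33
import Literature.NumberTheory.Sieve.MoebiusShiftedPrimesPrimeCharacterSum
import Literature.NumberTheory.LFunctions.VinogradovKorobovFromRichert
import Literature.NumberTheory.LFunctions.RichertBoundsFromExpSum
import Literature.NumberTheory.LFunctions.ExpSumBoundReduction
import Literature.NumberTheory.LFunctions.VinogradovZetaSumEstimate
import HarnessLib

/-!
# Möbius on shifted primes — Proposition 2.3 of Lichtman 2020 AS PRINTED, from the Vinogradov–Korobov input

Topic `Literature/NumberTheory/Sieve`.  This file closes the decomposition of the named fact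
`Literature.NumberTheory.Sieve.Lichtman2020_keyFourierEstimateLiouville`
(`MoebiusShiftedPrimesLiouville.lean`): J. D. Lichtman, *Averages of the Möbius function on shifted
primes*, Q. J. Math. 73 (2022) 729–757, arXiv:2009.08969v2 [Lichtman2020], **Proposition 2.3 as
printed** — the key Fourier estimate for `λ` on the refined typical sets `S_d` with the PRINTED first
interval `[P₁, Q₁] = [(log X)^{33A}, H/(log X)^{4A}]` and the PRINTED hypothesis
"`H = (log X)^{ψ(X)}`, `ψ(X) → ∞`, `ψ(X) ≤ (log X)^{2/3}`" — down to the one printed input of the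
paper that the tree does not prove, Lemma 4.5 (`Lichtman2020_primeCharacterSum`, the
Vinogradov–Korobov bound for prime character sums), itself reduced in the tree to Khale's explicit
Vinogradov–Korobov zero-free region for Dirichlet `L`-functions (`Khale2024_zeroFreeRegion`,
`Lichtman2020_primeCharacterSum_of_khale`):

* `Lichtman2020_keyFourierEstimateLiouville_of_primeCharacterSum :
    Lichtman2020_primeCharacterSum → Lichtman2020_keyFourierEstimateLiouville`,
* `Lichtman2020_keyFourierEstimateLiouville_of_khale :
    Khale2024_zeroFreeRegion → Lichtman2020_keyFourierEstimateLiouville`,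
* `Lichtman2020_keyFourierEstimateLiouville_of_vk :
    0 < c → HasVKZeroFreeRegion c T₀ → Lichtman2020_keyFourierEstimateLiouville` (any
  Vinogradov–Korobov region for Dirichlet `L`-functions, explicit or not, with any constant and any
  starting height, via `Lichtman2020_primeCharacterSum_of_vk`),
* `Lichtman2020_keyFourierEstimateLiouville_of_richertType`, `…_of_richert` : the same from
  Richert-type upper bounds for `ζ` and for the `L(s, χ)` of non-principal characters near `σ = 1`
  (`RichertTypeBound A B P ∧ RichertTypeBoundL A B P`, any constants, any power `P ≥ 0` of the
  logarithm — the output shape of Vinogradov's method), through the tree's Landau–Titchmarsh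
  deduction `hasVKZeroFreeRegion_of_richertType` (`VinogradovKorobovFromRichert.lean`),
* `Lichtman2020_keyFourierEstimateLiouville_of_expSumBound` : the same from Vinogradov's
  exponential-sum estimate with unspecified constants, `ExpSumBound C D` (`C ≥ 0`, `D > 0`:
  `‖∑_{N<n≤R} (n + u)^{−it}‖ ≤ C N^{1 − (log N)²/(D log² t)}` for `1 ≤ N < R ≤ 2N`, `N ≤ t`,
  `0 < u ≤ 1` — Ford 2002, Theorem 2, in shape), through `hasVKZeroFreeRegion_of_expSumBound`
  (`RichertBoundsFromExpSum.lean`).  This is the deepest input the tree reduces the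
  Vinogradov–Korobov region to; it is the target of the tree's decomposition of Vinogradov's mean
  value theorem (`VinogradovMeanValueCount.lean`, `VinogradovTorus.lean`, …).
* `Lichtman2020_keyFourierEstimateLiouville_of_vinogradovRange` : the same from Vinogradov's estimate
  in its natural range only, `VinogradovRangeBound K C c` (`K ≥ 1`, `C ≥ 0`, `c > 0`: the bound
  `C N^{1 − c(log N)²/(log t)²}` for `N^{K+1/2} ≤ t`), the small-`λ` range being van der Corput's
  (`expSumBound_of_vinogradovRange`, `ExpSumBoundReduction.lean`).

Why a new chain was needed.  The tree proves the circle method of §3 along the printed sets only in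
the regime `H ≤ exp((log X)^{2/3})` and only down to Proposition 3.4 with the printed saving `W^{-10}`
(`Lichtman2020_liouvilleMeanSquare`, a named fact), and `MoebiusShiftedPrimesTypical.lean` records
that the printed proof of Proposition 5.1 does not give that saving at `P₁ = (log X)^{33A}` (the
factor `V/(1 - e^{-2α/V}) ≍ V²` lost on p. 15), repairing the paper's Theorem 1.1 along the enlarged
sets `S_c`, `c ≥ 100`.  For Proposition 2.3 AS PRINTED the set is not negotiable, so the three
previous files re-tune the method instead: Proposition 5.1 at the printed `P₁` with the honest saving
`(log X)^{-3A}` (`MoebiusShiftedPrimesDirichletMeanValue33.lean`), Proposition 3.4 at every window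
length (`MoebiusShiftedPrimesMeanSquare33.lean`), and the major arcs by sub-windows of length
`≍ W^{-1/5}/|θ|` instead of the Abel summation (3.9), which need only that saving
(`MoebiusShiftedPrimesMajorArcs33.lean`, bound `HX/(dW^{1/5})`); all in the printed regime
`ψ(X) ≤ (log X)^{2/3}` taken literally (`H ≤ exp((log X)^{2/3} log log X)`).  This file supplies the
minor arcs in that regime (the tree's fixed-`X` bound `Lichtman2020.minorArc_sum_le`, Proposition 3.1,
re-wrapped: `log H ≤ (log X)^{2/3} log log X` still gives `600 HX log H/(d√W) ≤ 600 HX/(d^{3/4}W^{1/5})`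
for `A > 5`) and the deduction of Proposition 2.3 from the two arcs (p. 9, as
`Lichtman2020_keyFourierEstimateLiouville'_of_arcs`).

* `Lichtman2020.minorArc33_integral_le`, `Lichtman2020.minorArc33` — PROVED (Proposition 3.1 for
  the printed sets in the printed regime, `δ > 0`).
* `Lichtman2020_keyFourierEstimateLiouville_of_primeCharacterSum_of_liouvilleCharacterSifted`,
  `…_of_primeCharacterSum`, `…_of_khale`, `…_of_vk`, `…_of_richertType`, `…_of_richert`,
  `…_of_expSumBound`, `…_of_vinogradovRange` — PROVED.
* `Lichtman2020_keyFourierEstimateLiouville_holds` — THE DISCHARGE, from the tree's unconditional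
  Vinogradov–Korobov region `VKZeta.exists_hasVKZeroFreeRegion` (`VinogradovZetaSumEstimate.lean`).

No new definition and no named fact is introduced.  `Lichtman2020_keyFourierEstimateLiouville_holds`
needs exactly one input, a Vinogradov–Korobov zero-free region for Dirichlet `L`-functions — the named
fact `Khale2024_zeroFreeRegion`, or any `HasVKZeroFreeRegion c T₀` with `c > 0`, or Richert-type bounds
`RichertTypeBound A B P ∧ RichertTypeBoundL A B P`, or Vinogradov's exponential-sum estimate
`ExpSumBound C D` for some `C ≥ 0`, `D > 0`, or `VinogradovRangeBound K C c` for some `K ≥ 1`,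
`C ≥ 0`, `c > 0` (or directly `Lichtman2020_primeCharacterSum`) — and the tree now proves one:
`VKZeta.exists_hasVKZeroFreeRegion` (Vinogradov's mean value theorem and Ivić's Theorem 6.2,
`VinogradovMeanValue*.lean`, `VinogradovZetaSum*.lean`), which closes the fact.

## Source

* J. D. Lichtman, arXiv:2009.08969v2: Proposition 2.3 (p. 8); §3, Propositions 3.1, 3.2 and the
  deduction of Proposition 2.3 (p. 9); §3.1 (pp. 9–10); Lemma 4.5 (p. 12) [Lichtman2020].
* T. Khale, Q. J. Math. 75 (2024) 299–332, Theorem 1.1 [Khale2024].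
-/

noncomputable section

namespace Literature.NumberTheory.Sieve.Lichtman2020

open Filter Asymptotics Finset MeasureTheory
open scoped FourierTransform Topology

/-! ### The minor arcs for the printed sets in the printed regime -/

/-- **The minor arc bound, eventually, in the printed regime** (`A > 0`, `δ > 0`,
`ψ(X) = log H/log log X → ∞`, `ψ(X) ≤ (log X)^{2/3}`): for `X` large, all `1 ≤ d ≤ W = (log X)^A`,
all completely multiplicative `|g| ≤ 1` and all `α ∈ 𝔪(W, H/W⁴)`,
`∫₀^X |∑_{x ≤ nd ≤ x+H, n ∈ S_d} g(n) e(nα)| dx ≤ 600 HX log H/(d√W)` (the tree's fixed-`X` bound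
`minorArc_sum_le`, Proposition 3.1 / (3.1), whose inputs hold in this regime: `H ≤ X` and
`Q₁ = H/W⁴ < H < P₂ = exp((log X)^{2/3+δ/2})`, `eventually_H_lt_P2_of_psi`).
[cite: Lichtman2020, Proposition 3.1 and (3.1)] -/
theorem minorArc33_integral_le (A : ℝ) (hA : 0 < A) (δ : ℝ) (hδ : 0 < δ) (H : ℕ → ℕ)
    (hH : Tendsto (fun X : ℕ => Real.log (H X) / Real.log (Real.log X)) atTop atTop)
    (hψ : ∀ᶠ X : ℕ in atTop, Real.log (H X) / Real.log (Real.log X) ≤ Real.log X ^ (2 / 3 : ℝ)) :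
    ∀ᶠ X : ℕ in atTop, ∀ d : ℕ, 1 ≤ d → (d : ℝ) ≤ Real.log X ^ A →
      ∀ g : ℕ → ℂ, (∀ m n : ℕ, g (m * n) = g m * g n) → (∀ n : ℕ, ‖g n‖ ≤ 1) →
      ∀ α ∈ lichtmanMinorArcs (Real.log X ^ A) ((H X : ℝ) / Real.log X ^ (4 * A)),
        ∫ x in (0 : ℝ)..X,
            ‖twistedSum g ((Icc ⌈x / d⌉₊ ⌊(x + H X) / d⌋₊).filter (lichtmanTypical X A δ (H X))) α‖
          ≤ 600 * ((H X : ℝ) * X * Real.log (H X) / (d * Real.sqrt (Real.log X ^ A))) := by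
  have hW2 : ∀ᶠ X : ℕ in atTop, 2 ≤ Real.log X ^ A :=
    ((tendsto_rpow_atTop hA).comp tendsto_log_natCast).eventually_ge_atTop 2
  filter_upwards [eventually_H_le_exp_of_psi hψ (e := 3 / 4) (by norm_num),
    eventually_H_lt_P2_of_psi hψ hδ, hW2, eventually_three_le_H hH,
    tendsto_log_natCast.eventually_ge_atTop 1, eventually_gt_atTop 0]
    with X hHX hHP₂ hW2X h3 hL1 hX0 d hd hdW g hgmul hg α hα
  have hX0' : (0 : ℝ) < X := by exact_mod_cast hX0
  have hL0 : 0 < Real.log X := by linarith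
  set L : ℝ := Real.log X with hL
  set W : ℝ := L ^ A with hW
  have hW0 : 0 < W := by rw [hW]; exact Real.rpow_pos_of_pos hL0 _
  have hH0 : (0 : ℝ) < H X := by
    have : (3 : ℝ) ≤ H X := by exact_mod_cast h3
    linarith
  -- the parameters of `minorArc_sum_le`
  have hP₁ : L ^ (33 * A) = W ^ 33 := by
    rw [hW, ← Real.rpow_natCast, ← Real.rpow_mul hL0.le]
    norm_num
    ring_nf
  have hW4 : L ^ (4 * A) = W ^ 4 := by
    rw [hW, ← Real.rpow_natCast, ← Real.rpow_mul hL0.le]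
    norm_num
    ring_nf
  have hQ₁ : (H X : ℝ) / L ^ (4 * A) = (H X : ℝ) / W ^ 4 := by rw [hW4]
  have hHleX : H X ≤ X := by
    have h2 : L ^ (3 / 4 : ℝ) ≤ L := by
      calc L ^ (3 / 4 : ℝ) ≤ L ^ (1 : ℝ) := Real.rpow_le_rpow_of_exponent_le hL1 (by norm_num)
        _ = L := Real.rpow_one _
    have h3' : (H X : ℝ) ≤ X := by
      calc (H X : ℝ) ≤ Real.exp (L ^ (3 / 4 : ℝ)) := hHX
        _ ≤ Real.exp L := Real.exp_le_exp.mpr h2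
        _ = X := by rw [hL]; exact Real.exp_log hX0'
    exact_mod_cast h3'
  have hQP : (H X : ℝ) / L ^ (4 * A) < Real.exp (L ^ (2 / 3 + δ / 2)) := by
    have h1 : (H X : ℝ) / L ^ (4 * A) < H X := by
      rw [hW4, div_lt_iff₀ (by positivity)]
      have hW41 : 1 < W ^ 4 := by
        have : (2 : ℝ) ^ 4 ≤ W ^ 4 := pow_le_pow_left₀ (by norm_num) hW2X 4
        linarith [show (16 : ℝ) = 2 ^ 4 by norm_num]
      nlinarith
    exact h1.trans hHP₂
  rw [integral_window_div_eq_sum (fun s => ‖twistedSum g (s.filter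
    (lichtmanTypical X A δ (H X))) α‖) X (H X) d hd]
  exact minorArc_sum_le (P₁ := L ^ (33 * A)) (Q₂ := Real.exp (L ^ (1 - δ / 2))) hW2X hd hdW hP₁
    hQ₁ hQP h3 hHleX (lichtmanTypical X A δ (H X)) (fun n => Iff.rfl) g hgmul hg hα

/-- Eventually `log H · (log X)^{A/5} ≤ (log X)^{A/2}` in the printed regime (`A > 5`): indeed
`log H ≤ (log X)^{2/3} log log X` and `log log X ≤ (log X)^{3A/10 - 2/3}`. [folklore] -/
theorem eventually_logH_mul_rpow_le {A : ℝ} (hA : 5 < A) {H : ℕ → ℕ}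
    (hψ : ∀ᶠ X : ℕ in atTop, Real.log (H X) / Real.log (Real.log X) ≤ Real.log X ^ (2 / 3 : ℝ)) :
    ∀ᶠ X : ℕ in atTop, Real.log (H X) * Real.log X ^ (A / 5) ≤ Real.log X ^ (A / 2) := by
  have hε : 0 < A / 2 - A / 5 - 2 / 3 := by linarith
  filter_upwards [hψ, eventually_loglog_le_natCast (A / 2 - A / 5 - 2 / 3) 1 hε one_pos,
    (Real.tendsto_log_atTop.comp tendsto_log_natCast).eventually_gt_atTop 0,
    tendsto_log_natCast.eventually_gt_atTop 0] with X hX hll hll0 hl0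
  have h1 : Real.log (H X) ≤ Real.log X ^ (2 / 3 : ℝ) * Real.log (Real.log X) :=
    (div_le_iff₀ hll0).mp hX
  rw [one_mul] at hll
  calc Real.log (H X) * Real.log X ^ (A / 5)
      ≤ (Real.log X ^ (2 / 3 : ℝ) * Real.log (Real.log X)) * Real.log X ^ (A / 5) :=
        mul_le_mul_of_nonneg_right h1 (Real.rpow_nonneg hl0.le _)
    _ ≤ (Real.log X ^ (2 / 3 : ℝ) * Real.log X ^ (A / 2 - A / 5 - 2 / 3)) * Real.log X ^ (A / 5) := by
        refine mul_le_mul_of_nonneg_right ?_ (Real.rpow_nonneg hl0.le _)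
        exact mul_le_mul_of_nonneg_left hll (Real.rpow_nonneg hl0.le _)
    _ = Real.log X ^ (A / 2) := by
        rw [← Real.rpow_add hl0, ← Real.rpow_add hl0]; ring_nf

/-- **Proposition 3.1 of Lichtman 2020 for the printed sets in the printed regime** (`A > 5`, `δ > 0`;
bound `600 · HX/(d^{3/4} W^{1/5})`, `W = (log X)^A`): by `minorArc33_integral_le` the integral is at
most `600 HX log H/(d√W)`, and `log H · (log X)^{A/5} ≤ (log X)^{A/2}` (`eventually_logH_mul_rpow_le`),
`d^{3/4} ≤ d`. [cite: Lichtman2020, Proposition 3.1] -/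
theorem minorArc33 (A : ℝ) (hA : 5 < A) (δ : ℝ) (hδ : 0 < δ) (H : ℕ → ℕ)
    (hH : Tendsto (fun X : ℕ => Real.log (H X) / Real.log (Real.log X)) atTop atTop)
    (hψ : ∀ᶠ X : ℕ in atTop, Real.log (H X) / Real.log (Real.log X) ≤ Real.log X ^ (2 / 3 : ℝ)) :
    ∀ᶠ X : ℕ in atTop, ∀ d : ℕ, 1 ≤ d → (d : ℝ) ≤ Real.log X ^ A →
      ∀ g : ℕ → ℂ, (∀ m n : ℕ, g (m * n) = g m * g n) → (∀ n : ℕ, ‖g n‖ ≤ 1) →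
      ∀ α ∈ lichtmanMinorArcs (Real.log X ^ A) ((H X : ℝ) / Real.log X ^ (4 * A)),
        ∫ x in (0 : ℝ)..X,
            ‖twistedSum g ((Icc ⌈x / d⌉₊ ⌊(x + H X) / d⌋₊).filter (lichtmanTypical X A δ (H X))) α‖
          ≤ 600 * ((H X : ℝ) * X / ((d : ℝ) ^ (3 / 4 : ℝ) * Real.log X ^ (A / 5))) := by
  have hA0 : 0 < A := by linarith
  filter_upwards [minorArc33_integral_le A hA0 δ hδ H hH hψ, eventually_logH_mul_rpow_le hA hψ,
    eventually_three_le_H hH, tendsto_log_natCast.eventually_ge_atTop 1]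
    with X hX hkey h3 hL1 d hd hdW g hgmul hg α hα
  refine (hX d hd hdW g hgmul hg α hα).trans ?_
  set L : ℝ := Real.log X with hL
  have hL0 : 0 < L := by linarith
  have hH3 : (3 : ℝ) ≤ H X := by exact_mod_cast h3
  have hH0 : (0 : ℝ) < H X := by linarith
  have hd1 : (1 : ℝ) ≤ d := by exact_mod_cast hd
  have hd0 : (0 : ℝ) < d := by linarith
  have hlogH0 : 0 ≤ Real.log (H X) := Real.log_nonneg (by linarith)
  have hsqrt : Real.sqrt (L ^ A) = L ^ (A / 2) := by
    rw [Real.sqrt_eq_rpow, ← Real.rpow_mul hL0.le]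
    ring_nf
  have hd34 : (d : ℝ) ^ (3 / 4 : ℝ) ≤ d := by
    calc (d : ℝ) ^ (3 / 4 : ℝ) ≤ (d : ℝ) ^ (1 : ℝ) :=
          Real.rpow_le_rpow_of_exponent_le hd1 (by norm_num)
      _ = d := Real.rpow_one _
  have hHX0 : 0 ≤ (H X : ℝ) * X := by positivity
  apply mul_le_mul_of_nonneg_left _ (by norm_num)
  rw [hsqrt, div_le_div_iff₀ (by positivity) (by positivity)]
  calc (H X : ℝ) * X * Real.log (H X) * ((d : ℝ) ^ (3 / 4 : ℝ) * L ^ (A / 5))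
      = (H X : ℝ) * X * ((d : ℝ) ^ (3 / 4 : ℝ) * (Real.log (H X) * L ^ (A / 5))) := by ring
    _ ≤ (H X : ℝ) * X * (d * L ^ (A / 2)) := by
        apply mul_le_mul_of_nonneg_left _ hHX0
        exact mul_le_mul hd34 hkey (by positivity) (by positivity)

end Literature.NumberTheory.Sieve.Lichtman2020

namespace Literature.NumberTheory.Sieve

open Filter Asymptotics Finset MeasureTheory Lichtman2020
open scoped FourierTransform Topology

/-! ### Proposition 2.3 as printed -/

/-- **Lichtman 2020, Proposition 2.3 AS PRINTED, from Lemma 4.5 and Lemma 4.8** (p. 9: "We shall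
obtain Proposition 2.3 from the following results"): for `α ∈ ℝ` the integrand is `1`-periodic, so
`α` may be taken in `[0,1] = 𝔐 ∪ 𝔪`; on `𝔪` the proved Proposition 3.1 for the printed sets in the
printed regime (`Lichtman2020.minorArc33`, with `g = λ`), on `𝔐` the proved weak Proposition 3.2
(`Lichtman2020.majorArc33` at `c = 33`, `lichtmanTypicalWith 33 = lichtmanTypical`) and
`HX/(dW^{1/5}) ≤ HX/(d^{3/4}W^{1/5})`.  Hypotheses: the named facts Lemma 4.5
(`Lichtman2020_primeCharacterSum`) and Lemma 4.8 (`Lichtman2020_liouvilleCharacterSifted`).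
[cite: Lichtman2020, Proposition 2.3 and §3, p. 9] -/
theorem Lichtman2020_keyFourierEstimateLiouville_of_primeCharacterSum_of_liouvilleCharacterSifted
    (h45 : Lichtman2020_primeCharacterSum) (h48 : Lichtman2020_liouvilleCharacterSifted) :
    Lichtman2020_keyFourierEstimateLiouville := by
  intro A hA δ hδ H hH hψ
  have hA0 : 0 < A := by linarith
  obtain ⟨C₂, hC₂⟩ := Lichtman2020.majorArc33 h45 h48 33 le_rfl A hA δ hδ H hH hψ
  refine ⟨max (max 600 C₂) 0, ?_⟩
  have hlog1 : ∀ᶠ X : ℕ in atTop, 1 ≤ Real.log X :=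
    (Real.tendsto_log_atTop.comp tendsto_natCast_atTop_atTop).eventually_ge_atTop 1
  filter_upwards [minorArc33 A hA δ hδ H hH hψ, hC₂, hlog1] with X h1 h2 hL1 d hd hdW α
  set C : ℝ := max (max 600 C₂) 0 with hC
  have hC0 : 0 ≤ C := le_max_right _ _
  have hCC₁ : (600 : ℝ) ≤ C := (le_max_left _ _).trans (le_max_left _ _)
  have hCC₂ : C₂ ≤ C := (le_max_right _ _).trans (le_max_left _ _)
  have hd1 : (1 : ℝ) ≤ d := by exact_mod_cast hd
  have hd0 : (0 : ℝ) < d := by linarith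
  have hL0 : 0 < Real.log X := by linarith
  have hden₁ : 0 < (d : ℝ) ^ (3 / 4 : ℝ) * Real.log X ^ (A / 5) :=
    mul_pos (Real.rpow_pos_of_pos hd0 _) (Real.rpow_pos_of_pos hL0 _)
  have hden₂ : 0 < (d : ℝ) * Real.log X ^ (A / 5) := mul_pos hd0 (Real.rpow_pos_of_pos hL0 _)
  have hnum : 0 ≤ (H X : ℝ) * X := by positivity
  have hkey : (d : ℝ) ^ (3 / 4 : ℝ) * Real.log X ^ (A / 5) ≤ (d : ℝ) * Real.log X ^ (A / 5) := by
    refine mul_le_mul_of_nonneg_right ?_ (Real.rpow_nonneg hL0.le _)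
    calc (d : ℝ) ^ (3 / 4 : ℝ) ≤ (d : ℝ) ^ (1 : ℝ) :=
          Real.rpow_le_rpow_of_exponent_le hd1 (by norm_num)
      _ = d := Real.rpow_one _
  -- reduce to `α' = fract α ∈ [0, 1]`
  have hper : ∫ x in (0 : ℝ)..X, ‖liouvilleTwistedSum
      ((Icc ⌈x / d⌉₊ ⌊(x + H X) / d⌋₊).filter (lichtmanTypical X A δ (H X))) α‖ =
      ∫ x in (0 : ℝ)..X, ‖liouvilleTwistedSum
      ((Icc ⌈x / d⌉₊ ⌊(x + H X) / d⌋₊).filter (lichtmanTypical X A δ (H X))) (Int.fract α)‖ := by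
    simp_rw [liouvilleTwistedSum_fract]
  rw [hper]
  have hmem : Int.fract α ∈ Set.Icc (0 : ℝ) 1 := ⟨Int.fract_nonneg α, (Int.fract_lt_one α).le⟩
  rcases mem_majorArcs_or_minorArcs (W := Real.log X ^ A)
      (Q₁ := (H X : ℝ) / Real.log X ^ (4 * A)) hmem with hM | hm
  · -- major arcs: the weak Proposition 3.2 at `c = 33` (`lichtmanTypicalWith 33 = lichtmanTypical`)
    have hb := h2 d hd hdW (Int.fract α) hM
    -- `lichtmanTypicalWith 33 = lichtmanTypical` definitionally (`lichtmanTypicalWith_thirtyThree`),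
    -- together with their decidability instances
    have hb' : ∫ x in (0 : ℝ)..X, ‖liouvilleTwistedSum
        ((Icc ⌈x / d⌉₊ ⌊(x + H X) / d⌋₊).filter (lichtmanTypical X A δ (H X))) (Int.fract α)‖ ≤
        C₂ * ((H X : ℝ) * X / ((d : ℝ) * Real.log X ^ (A / 5))) := hb
    refine hb'.trans ?_
    calc C₂ * ((H X : ℝ) * X / ((d : ℝ) * Real.log X ^ (A / 5)))
        ≤ C * ((H X : ℝ) * X / ((d : ℝ) * Real.log X ^ (A / 5))) :=
          mul_le_mul_of_nonneg_right hCC₂ (div_nonneg hnum hden₂.le)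
      _ ≤ C * ((H X : ℝ) * X / ((d : ℝ) ^ (3 / 4 : ℝ) * Real.log X ^ (A / 5))) :=
          mul_le_mul_of_nonneg_left (div_le_div_of_nonneg_left hnum hden₁ hkey) hC0
  · -- minor arcs: Proposition 3.1 with `g = λ`
    have hgmul : ∀ m n : ℕ, (fun n : ℕ => ((ArithmeticFunction.liouville n : ℤ) : ℂ)) (m * n) =
        (fun n : ℕ => ((ArithmeticFunction.liouville n : ℤ) : ℂ)) m *
          (fun n : ℕ => ((ArithmeticFunction.liouville n : ℤ) : ℂ)) n := by
      intro m n
      simp only [ArithmeticFunction.liouville_apply_mul, Int.cast_mul]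
    have hgle : ∀ n : ℕ, ‖(fun n : ℕ => ((ArithmeticFunction.liouville n : ℤ) : ℂ)) n‖ ≤ 1 := by
      intro n
      simp only [Complex.norm_intCast]
      exact_mod_cast abs_liouville_le_one n
    have hb := h1 d hd hdW _ hgmul hgle (Int.fract α) hm
    simp_rw [← liouvilleTwistedSum_eq_twistedSum] at hb
    exact hb.trans (mul_le_mul_of_nonneg_right hCC₁ (div_nonneg hnum hden₁.le))

/-- **Lichtman 2020, Proposition 2.3 AS PRINTED, from Lemma 4.5 alone** (Lemma 4.8 being the tree's
proved `Lichtman2020_liouvilleCharacterSifted_holds`): the named fact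
`Lichtman2020_keyFourierEstimateLiouville` follows from the named fact `Lichtman2020_primeCharacterSum`
(the Vinogradov–Korobov bound for prime character sums). [cite: Lichtman2020, Proposition 2.3] -/
theorem Lichtman2020_keyFourierEstimateLiouville_of_primeCharacterSum
    (h45 : Lichtman2020_primeCharacterSum) : Lichtman2020_keyFourierEstimateLiouville :=
  Lichtman2020_keyFourierEstimateLiouville_of_primeCharacterSum_of_liouvilleCharacterSifted h45
    Lichtman2020_liouvilleCharacterSifted_holds

/-- **Lichtman 2020, Proposition 2.3 AS PRINTED, from Khale's Theorem 1.1** (the explicit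
Vinogradov–Korobov zero-free region for Dirichlet `L`-functions, the one printed input of the paper not
proved in the tree; Lemma 4.5 from it is `Lichtman2020_primeCharacterSum_of_khale`).
[cite: Lichtman2020, Proposition 2.3] [cite: Khale2024, Theorem 1.1] -/
theorem Lichtman2020_keyFourierEstimateLiouville_of_khale
    (hK : Literature.NumberTheory.LFunctions.Khale2024_zeroFreeRegion) :
    Lichtman2020_keyFourierEstimateLiouville :=
  Lichtman2020_keyFourierEstimateLiouville_of_primeCharacterSum
    (Lichtman2020.PrimeCharSum.Lichtman2020_primeCharacterSum_of_khale hK)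

/-- **Lichtman 2020, Proposition 2.3 AS PRINTED, from ANY Vinogradov–Korobov region for Dirichlet
`L`-functions** `HasVKZeroFreeRegion c T₀` (`c > 0`, any starting height `T₀`; the inexplicit printed
shape of the region, Khale (1.4) = Montgomery, *Ten lectures*, p. 176), through Lemma 4.5 in the form
`Lichtman2020_primeCharacterSum_of_vk`: so an inexplicit proof of the region (Vinogradov's method with
unspecified constants) discharges Proposition 2.3 as well.
[cite: Lichtman2020, Proposition 2.3 and Lemma 4.5] [cite: Khale2024, (1.4)] -/
theorem Lichtman2020_keyFourierEstimateLiouville_of_vk {c T₀ : ℝ} (hc : 0 < c)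
    (hVK : Literature.NumberTheory.LFunctions.HasVKZeroFreeRegion c T₀) :
    Lichtman2020_keyFourierEstimateLiouville :=
  Lichtman2020_keyFourierEstimateLiouville_of_primeCharacterSum
    (Lichtman2020.PrimeCharSum.Lichtman2020_primeCharacterSum_of_vk hc hVK)

/-- **Lichtman 2020, Proposition 2.3 AS PRINTED, from Richert-type bounds** for `ζ` and for the
`L(s, χ)` of non-principal characters with ANY constants `A, B` and ANY power `P ≥ 0` of the logarithm
(`RichertTypeBound A B P`: `|ζ(σ + it)| ≤ A|t|^{B(1−σ)^{3/2}}(log|t|)^P` for `|t| ≥ 3`, `1/2 ≤ σ ≤ 1`;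
`RichertTypeBoundL A B P`: the same with the factor `q^{1−σ}(1 + log q)` for `χ ≠ χ₀` mod `q` — the
output shape of Vinogradov's exponential-sum method, Titchmarsh §6.19 / Khale (2.4)), through the
tree's Landau–Titchmarsh deduction `hasVKZeroFreeRegion_of_richertType` and `…_of_vk`.
[cite: Lichtman2020, Proposition 2.3] [cite: Khale2024, (2.4) and Theorem B.1] -/
theorem Lichtman2020_keyFourierEstimateLiouville_of_richertType {A B P : ℝ}
    (hRζ : Literature.NumberTheory.LFunctions.RichertTypeBound A B P)
    (hRL : Literature.NumberTheory.LFunctions.RichertTypeBoundL A B P) (hP : 0 ≤ P) :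
    Lichtman2020_keyFourierEstimateLiouville := by
  obtain ⟨c, hc, hVK⟩ :=
    Literature.NumberTheory.LFunctions.hasVKZeroFreeRegion_of_richertType hRζ hRL hP
  exact Lichtman2020_keyFourierEstimateLiouville_of_vk hc hVK

/-- **Lichtman 2020, Proposition 2.3 AS PRINTED, from Richert-type bounds with the power `2/3` of the
logarithm** (`RichertBound A B`, e.g. Ford's Theorem 1 gives `(76.2, 4.45)` for `ζ`, and
`RichertBoundL A B`; any constants), via `hasVKZeroFreeRegion_of_richert`.
[cite: Lichtman2020, Proposition 2.3] [cite: Khale2024, (2.4) and Theorem B.1] -/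
theorem Lichtman2020_keyFourierEstimateLiouville_of_richert {A B : ℝ}
    (hRζ : Literature.NumberTheory.LFunctions.RichertBound A B)
    (hRL : Literature.NumberTheory.LFunctions.RichertBoundL A B) :
    Lichtman2020_keyFourierEstimateLiouville := by
  obtain ⟨c, hc, hVK⟩ := Literature.NumberTheory.LFunctions.hasVKZeroFreeRegion_of_richert hRζ hRL
  exact Lichtman2020_keyFourierEstimateLiouville_of_vk hc hVK

/-- **Lichtman 2020, Proposition 2.3 AS PRINTED, from Vinogradov's exponential-sum estimate with
unspecified constants** `ExpSumBound C D` (`C ≥ 0`, `D > 0`): for all integers `1 ≤ N < R ≤ 2N`,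
reals `t ≥ N` and shifts `0 < u ≤ 1`, `‖∑_{N<n≤R} (n + u)^{−it}‖ ≤ C N^{1 − (log N)²/(D log² t)}`
(K. Ford, Proc. LMS 85 (2002), Theorem 2, gives `(C, D) = (9.463, 133.66)`).  Route:
`ExpSumBound ⟹` Richert-type bounds for `ζ` and `L(s, χ)` (`RichertBoundsFromExpSum.lean`) `⟹`
a Vinogradov–Korobov region `HasVKZeroFreeRegion c 21` (`hasVKZeroFreeRegion_of_expSumBound`) `⟹`
Lemma 4.5 (`Lichtman2020_primeCharacterSum_of_vk`) `⟹` Proposition 2.3 (this file).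
[cite: Lichtman2020, Proposition 2.3 and Lemma 4.5] [cite: Ford2002, Theorem 2] -/
theorem Lichtman2020_keyFourierEstimateLiouville_of_expSumBound {C D : ℝ}
    (h : Literature.NumberTheory.LFunctions.ExpSumBound C D) (hC : 0 ≤ C) (hD : 0 < D) :
    Lichtman2020_keyFourierEstimateLiouville := by
  obtain ⟨c, hc, hVK⟩ :=
    Literature.NumberTheory.LFunctions.hasVKZeroFreeRegion_of_expSumBound h hC hD
  exact Lichtman2020_keyFourierEstimateLiouville_of_vk hc hVK

/-- **Lichtman 2020, Proposition 2.3 AS PRINTED, from Vinogradov's estimate in its natural range**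
`VinogradovRangeBound K C c` (`K ≥ 1`, `C ≥ 0`, `c > 0`): `‖∑_{N<n≤R} (n + u)^{−it}‖ ≤ C N^{1 − c(log N)²/(log t)²}`
only for `N^{K + 1/2} ≤ t` (the range `λ = log t/log N ≥ K + 1/2` of Vinogradov's method proper; the
complementary range is van der Corput's, `expSumBound_of_vinogradovRange`).  Route:
`VinogradovRangeBound ⟹ ExpSumBound` (`ExpSumBoundReduction.lean`) `⟹ …_of_expSumBound`.  This is the
last purely analytic reduction: `VinogradovRangeBound` follows from Vinogradov's mean value theorem
(Ivić 1985, Theorem 6.2 from Lemma 6.3).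
[cite: Lichtman2020, Proposition 2.3 and Lemma 4.5] [cite: Ford2002, Theorem 2] -/
theorem Lichtman2020_keyFourierEstimateLiouville_of_vinogradovRange {K : ℕ} (hK : 1 ≤ K) {C c : ℝ}
    (hC : 0 ≤ C) (hc : 0 < c) (h : Literature.NumberTheory.LFunctions.VinogradovRangeBound K C c) :
    Lichtman2020_keyFourierEstimateLiouville := by
  obtain ⟨C', D, hC', hD, hE⟩ :=
    Literature.NumberTheory.LFunctions.expSumBound_of_vinogradovRange hK hC hc h
  exact Lichtman2020_keyFourierEstimateLiouville_of_expSumBound hE hC' hD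

/-! ### The discharge -/

/-- **Lichtman 2020, Proposition 2.3 AS PRINTED — DISCHARGED.**  The one printed input of the paper
that the tree long carried as a named fact, the Vinogradov–Korobov zero-free region for Dirichlet
`L`-functions (Lemma 4.5 ⇐ Khale's (1.4)), is now a THEOREM of the tree:
`VKZeta.exists_hasVKZeroFreeRegion : ∃ c > 0, HasVKZeroFreeRegion c 21`
(`VinogradovZetaSumEstimate.lean`: Vinogradov's mean value theorem, Ivić's Lemmas 6.1–6.3,
`VinogradovMeanValue*.lean` ⟹ Ivić's Theorem 6.2 for the shifted zeta sums ⟹ `VinogradovRangeBound` ⟹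
`ExpSumBound` ⟹ Richert-type bounds ⟹ the region, `RichertBoundsFromExpSum.lean`), so Proposition 2.3
follows unconditionally through `Lichtman2020_keyFourierEstimateLiouville_of_vk`
(Lemma 4.5 `Lichtman2020_primeCharacterSum_of_vk`, then the four files of this chain).
[cite: Lichtman2020, Proposition 2.3] [cite: Ivic1985, Theorem 6.2 and Lemma 6.3] -/
theorem Lichtman2020_keyFourierEstimateLiouville_holds : Lichtman2020_keyFourierEstimateLiouville := by
  obtain ⟨c, hc, hVK⟩ := Literature.NumberTheory.LFunctions.VKZeta.exists_hasVKZeroFreeRegion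
  exact Lichtman2020_keyFourierEstimateLiouville_of_vk hc hVK

end Literature.NumberTheory.Sieve
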